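import Literature.AnabelianGeometry.AbsoluteAnabelian.AbsTopISemiAbsolute
import Literature.AnabelianGeometry.AbsoluteAnabelian.GaloisSubextensionProofs
import HarnessLib

/-!
# Elasticity passes to open subgroups ([AbsTopI] Def 1.1 (ii), §0 conventions)

S. Mochizuki, *Topics in Absolute Anabelian Geometry I: Generalities* (2012) [AbsTopI] (lit key
`paper:url-11ac98ba15fc`), Def 1.1 (ii) p. 10: "We shall say that `G` is elastic if it holds that every
topologically finitely generated closed normal subgroup `N ⊆ H` of an open subgroup `H ⊆ G` of `G` is
either trivial or of finite index in `G`."  Since an open subgroup of an open subgroup `U ⊆ G` is open in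
`G`, and finite index in `G` implies finite index in `U`, the definition is HEREDITARY to open subgroups —
the formal step behind "we may always replace `k` by a finite extension of `k`" in the proof of Thm 1.7 (ii)
(p. 14) and behind passing to open subgroups `Π_U ⊆ Π_X` throughout [AbsTopI] §2, §4.

PROOF-ONLY file (no definitions, no named facts): `IsElastic.subgroup_of_isOpen` — if `G` is elastic and
`U ⊆ G` is an open subgroup, then `U` (with the subspace topology) is elastic; and the packaged form for the
typed predicate on a fundamental extension.  Classical; nothing here bears on [IUTchIII] Cor. 3.12.
-/

noncomputable section

open Topology

universe u

namespace Literature.AnabelianGeometry.AbsoluteAnabelian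

variable {G : Type u} [Group G] [TopologicalSpace G] [IsTopologicalGroup G]

/-- **Open subgroups of elastic groups are elastic** ([AbsTopI] Def 1.1 (ii)): for `G` elastic and
`U ⊆ G` open, every topologically finitely generated closed normal subgroup `N` of an open subgroup
`H ⊆ U` is trivial or of finite index in `U` (push `H`, `N` forward along `U ↪ G`: `H` stays open, `N`
closed and topologically finitely generated, and `[G : N] < ∞ ⇒ [U : N] < ∞`).
[cite: MochizukiAbsTopI2012, Def 1.1 (ii) p.10] -/
theorem IsElastic.subgroup_of_isOpen (hG : IsElastic G) (U : Subgroup G) (hUo : IsOpen (U : Set G)) :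
    IsElastic U := by
  classical
  refine ⟨fun H N hHo hNH hNn hNc hNfg => ?_⟩
  have hUc : IsClosed (U : Set G) := Subgroup.isClosed_of_isOpen U hUo
  -- push forward along `U ↪ G`
  let H' : Subgroup G := H.map U.subtype
  let N' : Subgroup G := N.map U.subtype
  have hcoe : ∀ S : Subgroup U, ((S.map U.subtype : Subgroup G) : Set G) = Subtype.val '' (S : Set U) := by
    intro S; ext x; simp only [Subgroup.coe_map, Set.mem_image, SetLike.mem_coe]; rfl
  have hH'o : IsOpen (H' : Set G) := by
    rw [hcoe]; exact hUo.isOpenMap_subtype_val _ hHo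
  have hN'c : IsClosed (N' : Set G) := by
    rw [hcoe]; exact hUc.isClosedEmbedding_subtypeVal.isClosedMap _ hNc
  have hN'H' : N' ≤ H' := Subgroup.map_mono hNH
  have hmemN' : ∀ {x : G}, x ∈ N' ↔ ∃ hx : x ∈ U, (⟨x, hx⟩ : U) ∈ N := by
    intro x
    constructor
    · rintro ⟨y, hy, rfl⟩; exact ⟨y.2, by simpa using hy⟩
    · rintro ⟨hx, h⟩; exact ⟨⟨x, hx⟩, h, rfl⟩
  have hmemH' : ∀ {x : G}, x ∈ H' ↔ ∃ hx : x ∈ U, (⟨x, hx⟩ : U) ∈ H := by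
    intro x
    constructor
    · rintro ⟨y, hy, rfl⟩; exact ⟨y.2, by simpa using hy⟩
    · rintro ⟨hx, h⟩; exact ⟨⟨x, hx⟩, h, rfl⟩
  have hN'n : (N'.subgroupOf H').Normal := by
    refine ⟨fun n hn g => ?_⟩
    rw [Subgroup.mem_subgroupOf] at hn ⊢
    obtain ⟨hgU, hgH⟩ := hmemH'.mp g.2
    obtain ⟨hnU, hnN⟩ := hmemN'.mp hn
    have h1 := hNn.conj_mem ⟨⟨(n : G), hnU⟩, hNH hnN⟩
      (by rw [Subgroup.mem_subgroupOf]; exact hnN) ⟨⟨(g : G), hgU⟩, hgH⟩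
    rw [Subgroup.mem_subgroupOf] at h1
    have hx : ((g : G) * n * (g : G)⁻¹) ∈ U := U.mul_mem (U.mul_mem hgU hnU) (U.inv_mem hgU)
    refine hmemN'.mpr ⟨hx, ?_⟩
    have key : (⟨(g : G) * n * (g : G)⁻¹, hx⟩ : U) =
        ⟨(g : G), hgU⟩ * ⟨(n : G), hnU⟩ * (⟨(g : G), hgU⟩)⁻¹ := rfl
    have h2 : (⟨(g : G) * n * (g : G)⁻¹, hx⟩ : U) ∈ N := by rw [key]; exact h1
    exact h2
  -- `N ≅ N'`, so `N'` is topologically finitely generated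
  let f : N →ₜ* N' :=
    { toFun := fun n => ⟨(n : U), ⟨n, n.2, rfl⟩⟩
      map_one' := Subtype.ext rfl
      map_mul' := fun _ _ => Subtype.ext rfl
      continuous_toFun :=
        (continuous_subtype_val.comp continuous_subtype_val).subtype_mk _ }
  have hf : Function.Surjective f := by
    rintro ⟨x, hx⟩
    obtain ⟨hxU, hxN⟩ := hmemN'.mp hx
    exact ⟨⟨⟨x, hxU⟩, hxN⟩, Subtype.ext rfl⟩
  have hN'fg : IsTopologicallyFinitelyGenerated N' := IsTopologicallyFinitelyGenerated.of_surjective f hf hNfg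
  -- elasticity of `G`
  rcases hG.eq_bot_or_finiteIndex H' N' hH'o hN'H' hN'n hN'c hN'fg with h | h
  · left
    rw [eq_bot_iff]
    intro n hn
    have : ((n : U) : G) ∈ N' := ⟨n, hn, rfl⟩
    rw [h, Subgroup.mem_bot] at this
    exact Subgroup.mem_bot.mpr (Subtype.ext this)
  · right
    have hidx : N'.index = N.index * U.index := Subgroup.index_map_subtype N
    refine ⟨fun h0 => h.index_ne_zero ?_⟩
    rw [hidx, h0, zero_mul]

namespace FundamentalExtension

/-- For a fundamental extension `1 → Δ → Π → G → 1`: if `Π` is elastic then so is every open subgroup of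
`Π` (e.g. `Π_U` for a finite étale covering `U → X`). [cite: MochizukiAbsTopI2012, Def 1.1 (ii) p.10] -/
theorem isElastic_subgroup_of_isOpen (E : FundamentalExtension.{u}) (hPi : IsElastic E.arith)
    (H : Subgroup E.arith) (hH : IsOpen (H : Set E.arith)) : IsElastic H :=
  hPi.subgroup_of_isOpen H hH

end FundamentalExtension

end Literature.AnabelianGeometry.AbsoluteAnabelian

end
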